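import Summits.CriticalPhenomena.PercolationContinuityZ3.Theorems.Transplant.KNCells2RootRunBandRO
import HarnessLib

/-!
# (R) under D″, planar: the STANDARD root band run of SIGN-PARAMS.md (A5) — start level `caStd r e R' = 5r + 1 + e + 2R'` (the landing
# row one stride-plus-margins above the wired cube), stride `s₁ = e` (short, p3-g7 ruling 2026-08-21T06:32:17Z), `ℓ₀ = e − R'`, step count
# `nStd r e R' = ⌈(17r − ca)/e⌉` (so the far line core lands in `[17r, 17r + e) ⊆ [17r, 23r]`), transverse centre `0`, region half-width
# `ρ = q' + (N+1)R' + 2WM` — and **`RootRun2.rootBandOKR_std`**: these values satisfy `RootBandOKR` (hence feed `rootSchedRO` and the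
# schedule-generic (R) assembly) from FIVE small inequalities the params layer has by construction (`1 ≤ e`, `2R' ≤ e`, `e + 2R' + 2 ≤ 12r∥`,
# `e ≤ 6r∥`, `12·r∥·R' ≤ e·r⊥`) and the two spread bounds `8q' ≤ r⊥`, `8WM ≤ r⊥` — pure `Site 2`/ℕ arithmetic, no new design

builds on p205010 (kernel theorem, internal audit signed; external expert review pending) — nothing in this file uses p205010.
Lane `prim-bschramm-*`, seat `prim-bschramm-p2` (gen 8); helper file (`--supports stmt-CriticalPhenomena-4575 --as helper`).
* `RootRun2.caStd`, `RootRun2.nStd`, `nStd_pos`, `le_nStd_mul` / `nStd_mul_le` (the ceiling bracket), `nStd_mul_le_twelve`;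
* **`RootRun2.rootBandOKR_std`**.
[cite: KozmaNitzan2024, §4 p. 28 ((32) at the root), Lemma 11 (pp. 22–23)]
-/

noncomputable section

namespace Summit.CriticalPhenomena.PercolationContinuityZ3.Theorems

namespace Transplant

namespace RootRun2

open Literature.Probability.Percolation Literature.Probability.LatticeModels
open Literature.Probability.Percolation.KozmaNitzan
open Literature.Probability.Percolation.KozmaNitzan.Cells (oth oth_ne eq_oth_of_ne sgOf sgOf_sign)
open ChainPlanar

/-- **The standard start level** of the root band run: `5r + 1 + e + 2R'` (the landing row; region `0` then starts at `5r + 1`, just above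
the wired root cube). [this work] -/
def caStd (r e R' : ℕ) : ℤ := 5 * (r : ℤ) + 1 + e + 2 * R'

/-- **The standard number of band steps** `N + 1 = ⌈(17r − ca)/e⌉ = ⌈(12r − 1 − e − 2R')/e⌉`. [this work] -/
def nStd (r e R' : ℕ) : ℕ := (12 * r - 2 - 2 * R') / e

section Arith

variable {r e R' : ℕ} (he : 1 ≤ e) (hbig : e + 2 * R' + 2 ≤ 12 * r)
include he hbig

/-- The ceiling bracket, lower half: `12r − 1 − e − 2R' ≤ nStd · e`. [folklore] -/
theorem le_nStd_mul : 12 * (r : ℤ) - 1 - e - 2 * R' ≤ (nStd r e R' : ℤ) * e := by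
  have h1 : 12 * r - 2 - 2 * R' < (12 * r - 2 - 2 * R') / e * e + e := Nat.lt_div_mul_add (by omega)
  have h2 : ((12 * r - 2 - 2 * R' : ℕ) : ℤ) = 12 * (r : ℤ) - 2 - 2 * R' := by
    have : 2 + 2 * R' ≤ 12 * r := by omega
    push_cast [Nat.sub_sub, Nat.cast_sub (by omega : 2 + 2 * R' ≤ 12 * r)]
    ring
  have h3 : ((12 * r - 2 - 2 * R' : ℕ) : ℤ) < ((12 * r - 2 - 2 * R') / e * e + e : ℕ) := by exact_mod_cast h1
  rw [h2] at h3
  unfold nStd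
  push_cast at h3 ⊢
  linarith

/-- The ceiling bracket, upper half: `nStd · e ≤ 12r − 2 − 2R'`. [folklore] -/
theorem nStd_mul_le : (nStd r e R' : ℤ) * e ≤ 12 * (r : ℤ) - 2 - 2 * R' := by
  have h1 : (12 * r - 2 - 2 * R') / e * e ≤ 12 * r - 2 - 2 * R' := Nat.div_mul_le_self _ _
  have h2 : ((12 * r - 2 - 2 * R' : ℕ) : ℤ) = 12 * (r : ℤ) - 2 - 2 * R' := by
    push_cast [Nat.sub_sub, Nat.cast_sub (by omega : 2 + 2 * R' ≤ 12 * r)]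
    ring
  have h3 : (((12 * r - 2 - 2 * R') / e * e : ℕ) : ℤ) ≤ ((12 * r - 2 - 2 * R' : ℕ) : ℤ) := by exact_mod_cast h1
  rw [h2] at h3
  unfold nStd
  push_cast at h3 ⊢
  linarith

/-- At least one band step. [folklore] -/
theorem nStd_pos : 1 ≤ nStd r e R' := by
  have h := le_nStd_mul (r := r) he hbig
  by_contra h0
  push Not at h0
  have : nStd r e R' = 0 := by omega
  rw [this] at h
  push_cast at h
  have : (e : ℤ) + 2 * R' + 2 ≤ 12 * r := by exact_mod_cast hbig
  linarith

/-- `nStd · e ≤ 12 r`. [folklore] -/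
theorem nStd_mul_le_twelve : (nStd r e R' : ℤ) * e ≤ 12 * (r : ℤ) := by
  have := nStd_mul_le (r := r) he hbig
  have hR : (0 : ℤ) ≤ R' := by positivity
  linarith

end Arith

/-- **THE STANDARD ROOT BAND RUN IS ADMISSIBLE** (rooted admissibility, SIGN-PARAMS.md (A5)): stride `e`, `ℓ₀ = e − R'`, `N + 1 = nStd r∥ e R'`
steps from the row at level `caStd r∥ e R'`, transverse centre `0`, start half-width `q'`, spreads `Wb ≤ WM` on `[0, e + R']`, region half-width
`ρ = q' + (N+1)R' + 2WM` — from `1 ≤ e`, `2R' ≤ e`, `e + 2R' + 2 ≤ 12 r∥`, `e ≤ 6 r∥`, `12·r∥·R' ≤ e·r⊥`, `8q' ≤ r⊥`, `8WM ≤ r⊥`.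
[cite: KozmaNitzan2024, §4 p. 28 ((32) at the root), Lemma 11 (pp. 22–23)] -/
theorem rootBandOKR_std (P : PCells2) (du : MDir) {e R' WM : ℕ} {q' : ℤ} {Wb : ℕ → ℕ}
    (he : 1 ≤ e) (hR'e : 2 * R' ≤ e) (hbig : e + 2 * R' + 2 ≤ 12 * P.r du.1) (he6 : e ≤ 6 * P.r du.1)
    (hq'0 : 0 ≤ q') (hq' : 8 * q' ≤ (P.r (oth du.1) : ℤ)) (hWM : 8 * WM ≤ P.r (oth du.1))
    (hNR : 12 * P.r du.1 * R' ≤ e * P.r (oth du.1))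
    (hWb : ∀ ℓ : ℕ, (ℓ : ℤ) ≤ 2 * (0 : ℤ) + (e : ℤ) + R' → Wb ℓ ≤ WM) :
    RootBandOKR P du e R' (e - R') (nStd (P.r du.1) e R' - 1) WM Wb (caStd (P.r du.1) e R') 0 q'
      (q' + (nStd (P.r du.1) e R' : ℤ) * R' + 2 * WM) := by
  set r := P.r du.1 with hr
  set r' := P.r (oth du.1) with hr'
  set n := nStd r e R' with hn
  have hn1 : 1 ≤ n := nStd_pos he hbig
  have hN1 : (((n - 1 : ℕ) : ℤ) + 1) = (n : ℤ) := by push_cast [Nat.cast_sub hn1]; ring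
  have hlo' := le_nStd_mul (r := r) he hbig
  have hhi' := nStd_mul_le (r := r) he hbig
  have h12 := nStd_mul_le_twelve (r := r) he hbig
  have hR0 : (0 : ℤ) ≤ R' := by positivity
  have hW0 : (0 : ℤ) ≤ WM := by positivity
  have he0 : (0 : ℤ) < e := by exact_mod_cast he
  have hr'1 : (1 : ℤ) ≤ r' := by exact_mod_cast P.one_le_r (oth du.1)
  -- `(N+1) R' ≤ r⊥`: `n·e·R' ≤ 12 r∥ R' ≤ e·r⊥`
  have hnR : (n : ℤ) * R' ≤ r' := by
    have h1 : (n : ℤ) * e * R' ≤ 12 * (r : ℤ) * R' := by nlinarith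
    have h2 : 12 * (r : ℤ) * R' ≤ (e : ℤ) * r' := by exact_mod_cast hNR
    nlinarith
  have hWM' : 8 * (WM : ℤ) ≤ r' := by exact_mod_cast hWM
  refine
    { hq := le_rfl
      hq' := hq'0
      hs := ?_
      hs2 := by exact_mod_cast hR'e
      hρ := by rw [hN1]
      hWM := hWb
      hlo := ?_
      hhi := ?_
      htr := ?_
      hloM := ?_
      hhiM := ?_
      htrM := ?_ }
  · -- `R' + (e − R') ≤ e`
    have : R' ≤ e := by omega
    push_cast [Nat.cast_sub this]; linarith
  · -- region `0` starts right above the wired cube: `5r + 1 + (0 + e + 2R') ≤ ca` (equality)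
    simp only [caStd, Adv.ρ₀]; linarith
  · -- `ca + (N+1) e ≤ 25 r`
    rw [hN1]; simp only [caStd]
    have : (e : ℤ) ≤ 6 * r := by exact_mod_cast he6
    nlinarith
  · -- `|0| + ρ ≤ 5 r⊥ − 1`
    rw [abs_zero, zero_add]; nlinarith
  · -- `17 r ≤ ca + (N+1) e`
    rw [hN1]; simp only [caStd]; nlinarith
  · -- `ca + (N+1) e ≤ 23 r`
    rw [hN1]; simp only [caStd]
    have : (e : ℤ) ≤ 6 * r := by exact_mod_cast he6
    nlinarith
  · -- `|0| + w₁ + N R' ≤ 3 r⊥`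
    rw [abs_zero, zero_add, Band.w₁]
    have hN' : ((n - 1 : ℕ) : ℤ) * R' ≤ (n : ℤ) * R' - R' := by
      push_cast [Nat.cast_sub hn1]; nlinarith
    nlinarith

end RootRun2

end Transplant

end Summit.CriticalPhenomena.PercolationContinuityZ3.Theorems

end
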